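import Summits.CriticalPhenomena.CardyFormulaZ2.Theorems.CardyBondTriangularBondTriangularBoxCrossingDefs
import Literature.Probability.LatticeModels.TriangularLattice
import HarnessLib

/-!
# Route CardyBondTriangular — item `BondTriangularBoxCrossing`: the state of the track-pushing sweep

Support file for the unconditional proof of the route item `BondTriangularBoxCrossing`
(stmt-CriticalPhenomena-7023). Grimmett–Manolescu (PTRF 159 (2014) = arXiv:1204.0505, §7) prove
the box-crossing property of a graph `G ∈ 𝒢` by pushing, with finitely many star–triangle
transformations, all track intersections of the third kind out of a slab between two parallel
tracks `s_0`, `s_N`, after which the slab is a box of an isoradial square lattice. For the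
triangular lattice `𝕋` (labels `(b, m) ∈ ℤ²`, rows `m`, the three edge families
`h(b,m) = {(b,m),(b+1,m)}` (horizontal), `v(b,m) = {(b,m),(b,m+1)}`, `d(b,m) = {(b+1,m),(b,m+1)}`)
this procedure is completely explicit, and — with one spare label, renamed after each
star → triangle move — it keeps every vertex label in place:

* the *chain* `(j, a)` pushes the horizontal edge `h(a, j)` vertically upwards; it consists of
  the *double steps* at the up-faces `(a − k, j + 2k)`, `k = 0, 1, …` (triangle → star at the
  up-face `{(b,m), (b+1,m), (b,m+1)}`, star → triangle at the apex `(b, m+1)`, rename), each of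
  which changes six weights: `h(b,m) : t ↦ 0`, `v(b,m), d(b,m) : t ↦ 1−t`,
  `v(b,m+1), d(b−1,m+1) : 1−t ↦ t`, `h(b−1,m+2) : 0 ↦ t`; at the top level `N − 1` the chain
  ends with a *half step* (`h ↦ 0`, `v, d ↦ 1 − t`), at level `N` with the deletion of the
  travelling horizontal edge;
* chains are performed for the rows `j = N−1, N−2, …, 1` (downwards) and, within a row, for
  `a = lo − j, …, L` (a dependency-closed staircase).

This file fixes the bookkeeping: the *state* `(j, a, k)` (all chains of the rows `> j` done, the
chains `(j, a')`, `a' < a`, done, and `k` steps of the chain `(j, a)` done), the predicate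
`DoneFace` ("the chain of row `r` through the up-face `(b, m)` has already acted on it"), and the
resulting **closed form of the weights** `weight C σ : Sym2 (Site 2) → unitInterval` at every state
(`wH`, `wV`, `wD` on the three edge families, `0` elsewhere), together with the evaluation lemmas
and the effect of one step on `DoneFace` (`doneFace_succ_iff`). No probability here.

## References

* G. R. Grimmett, I. Manolescu, PTRF 159 (2014), arXiv:1204.0505, §7 (proof of Thm 3.1, Lemma 7.x
  "grid slide": the black points are moved above `s_1` one by one).
-/

noncomputable section

namespace Summit.CriticalPhenomena.CardyFormulaZ2.Theorems.TriSweep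

open Literature.Probability.LatticeModels

/-! ### Evaluation of the weights -/

variable (C : Cfg)

section Weights

variable (t : unitInterval)

/-- **General evaluation**: the weight of `{(b,m), (b',m')}` is the weight of the slot it is, and
`0` if it is not an edge slot of `𝕋`. -/
theorem weight_pt_pt (σ : St) (b m b' m' : ℤ) :
    weight C t σ s(pt b m, pt b' m') =
      if b' = b + 1 ∧ m' = m then wH C t σ b m
      else if b = b' + 1 ∧ m = m' then wH C t σ b' m'
      else if b' = b ∧ m' = m + 1 then wV C t σ b m
      else if b = b' ∧ m = m' + 1 then wV C t σ b' m'
      else if b = b' + 1 ∧ m' = m + 1 then wD C t σ b' m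
      else if b' = b + 1 ∧ m = m' + 1 then wD C t σ b m'
      else 0 := by
  rw [weight_mk]; unfold wPair; simp only [pt_zero, pt_one]

/-- Evaluation on a horizontal slot. -/
theorem weight_h (σ : St) (b m : ℤ) : weight C t σ s(pt b m, pt (b + 1) m) = wH C t σ b m := by
  rw [weight_pt_pt, if_pos ⟨rfl, rfl⟩]

/-- Evaluation on a `v`-slot. -/
theorem weight_v (σ : St) (b m : ℤ) : weight C t σ s(pt b m, pt b (m + 1)) = wV C t σ b m := by
  rw [weight_pt_pt, if_neg (by omega), if_neg (by omega), if_pos ⟨rfl, rfl⟩]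

/-- Evaluation on a `d`-slot. -/
theorem weight_d (σ : St) (b m : ℤ) :
    weight C t σ s(pt (b + 1) m, pt b (m + 1)) = wD C t σ b m := by
  rw [weight_pt_pt, if_neg (by omega), if_neg (by omega), if_neg (by omega), if_neg (by omega),
    if_pos ⟨rfl, rfl⟩]

end Weights

/-! ### Arithmetic of `DoneFace` -/

section DoneFace

variable {C}

/-- One more step of the current chain acts on exactly one more face: the face
`(a − k, j + 2k)` of row `j` (if that chain step exists). -/
theorem doneFace_succ_iff (σ : St) (hk : 0 ≤ σ.k) (b m r : ℤ) :
    DoneFace C σ.succ b m r ↔ DoneFace C σ b m r ∨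
      (r = σ.j ∧ b = σ.a - σ.k ∧ m = σ.j + 2 * σ.k ∧ 1 ≤ σ.j ∧ m ≤ C.N - 1 ∧
        C.lo - σ.j ≤ σ.a ∧ σ.a ≤ C.L) := by
  simp only [DoneFace, St.succ]
  constructor
  · rintro ⟨i, hi0, hir, hr1, hmN, hlo, hL, hdone⟩
    rcases hdone with h | ⟨rfl, h | ⟨h, hik⟩⟩
    · exact Or.inl ⟨i, hi0, hir, hr1, hmN, hlo, hL, Or.inl h⟩
    · exact Or.inl ⟨i, hi0, hir, hr1, hmN, hlo, hL, Or.inr ⟨rfl, Or.inl h⟩⟩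
    · rcases lt_or_eq_of_le (Int.lt_add_one_iff.1 hik) with hik | hik
      · exact Or.inl ⟨i, hi0, hir, hr1, hmN, hlo, hL, Or.inr ⟨rfl, Or.inr ⟨h, hik⟩⟩⟩
      · right
        refine ⟨rfl, by omega, by omega, hr1, hmN, by omega, by omega⟩
  · rintro (⟨i, hi0, hir, hr1, hmN, hlo, hL, hdone⟩ | ⟨rfl, hb, hm, hj1, hmN, hlo, hL⟩)
    · refine ⟨i, hi0, hir, hr1, hmN, hlo, hL, ?_⟩
      rcases hdone with h | ⟨rfl, h | ⟨h, hik⟩⟩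
      · exact Or.inl h
      · exact Or.inr ⟨rfl, Or.inl h⟩
      · exact Or.inr ⟨rfl, Or.inr ⟨h, by omega⟩⟩
    · exact ⟨σ.k, hk, by omega, hj1, hmN, by omega, by omega, Or.inr ⟨rfl, Or.inr ⟨by omega, by omega⟩⟩⟩

/-- `DoneFace` is monotone along a step. -/
theorem DoneFace.succ {σ : St} (hk : 0 ≤ σ.k) {b m r : ℤ} (h : DoneFace C σ b m r) :
    DoneFace C σ.succ b m r :=
  (doneFace_succ_iff σ hk b m r).2 (Or.inl h)

/-- The face acted on by the current step was not done before. -/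
theorem not_doneFace_current (σ : St) :
    ¬ DoneFace C σ (σ.a - σ.k) (σ.j + 2 * σ.k) σ.j := by
  rintro ⟨i, hi0, hir, -, -, -, -, hdone⟩
  rcases hdone with h | ⟨-, h | ⟨h, hik⟩⟩ <;> omega

/-- A done face whose row is not the current row, or whose position is not the current one,
stays characterised by the same data; conversely the rows below the current row are untouched. -/
theorem doneFace_row_lt {σ : St} {b m r : ℤ} (h : DoneFace C σ b m r) : σ.j ≤ r := by
  obtain ⟨i, -, -, -, -, -, -, hdone⟩ := h
  rcases hdone with h | ⟨rfl, -⟩ <;> omega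

end DoneFace

/-! ### The facts about one step of the sweep -/

section StepFacts

variable {C}

variable {σ : St} (H : StepHyp C σ)
include H

/-- The face of the current step has already been stepped by every row `j + 2s`, `1 ≤ s ≤ k`,
above the current row. -/
theorem StepHyp.doneFace_above {s : ℤ} (hs1 : 1 ≤ s) (hsk : s ≤ σ.k)
    (hm : σ.j + 2 * σ.k ≤ C.N - 1) :
    DoneFace C σ (σ.a - σ.k) (σ.j + 2 * σ.k) (σ.j + 2 * s) := by
  obtain ⟨hj1, hjN, hlo0, hL0, hk0⟩ := id H
  refine ⟨σ.k - s, by omega, by omega, by omega, hm, ?_, ?_, Or.inl (by omega)⟩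
  · omega
  · omega

/-- **Before the step, `v` at the current face is `t`**: its flag is down. -/
theorem StepHyp.not_flagV_cur : ¬ FlagV C σ (σ.a - σ.k) (σ.j + 2 * σ.k) := by
  obtain ⟨hj1, hjN, hlo0, hL0, hk0⟩ := id H
  rintro ⟨r, ⟨i, hi0, hir, hr1, hmN, hlo, hL, hdone⟩, hnd⟩
  apply hnd
  have hrj : σ.j < r := by
    rcases hdone with h | ⟨rfl, h | ⟨h, hik⟩⟩
    · exact h
    · omega
    · omega
  exact ⟨i, hi0, by omega, by omega, by omega, by omega, by omega, Or.inl (by omega)⟩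

/-- **Before the step, `d` at the current face is `t`**: its flag is down. -/
theorem StepHyp.not_flagD_cur : ¬ FlagD C σ (σ.a - σ.k) (σ.j + 2 * σ.k) := by
  obtain ⟨hj1, hjN, hlo0, hL0, hk0⟩ := id H
  rintro ⟨r, ⟨i, hi0, hir, hr1, hmN, hlo, hL, hdone⟩, hnd⟩
  apply hnd
  have hrj : σ.j < r := by
    rcases hdone with h | ⟨rfl, h | ⟨h, hik⟩⟩
    · exact h
    · omega
    · omega
  exact ⟨i, hi0, by omega, by omega, by omega, by omega, by omega, Or.inl (by omega)⟩

/-- **Before a double step, the upper `v`-edge of the apex is `1 − t`**: its flag is up (set by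
the chain `(j + 1, a)`). -/
theorem StepHyp.flagV_apex (hm : σ.j + 2 * σ.k + 1 ≤ C.N - 1) :
    FlagV C σ (σ.a - σ.k) (σ.j + 2 * σ.k + 1) := by
  obtain ⟨hj1, hjN, hlo0, hL0, hk0⟩ := id H
  refine ⟨σ.j + 1, ⟨σ.k, H.k_nonneg, by ring, by omega, hm, ?_, ?_, Or.inl (by omega)⟩, ?_⟩
  · omega
  · omega
  · have := not_doneFace_current (C := C) σ
    rwa [show σ.j + 2 * σ.k + 1 - 1 = σ.j + 2 * σ.k by ring, show σ.j + 1 - 1 = σ.j by ring]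

/-- **Before a double step, the upper `d`-edge of the apex is `1 − t`**: its flag is up (set by
the chain `(j + 1, a − 1)`). -/
theorem StepHyp.flagD_apex (hm : σ.j + 2 * σ.k + 1 ≤ C.N - 1) :
    FlagD C σ (σ.a - σ.k - 1) (σ.j + 2 * σ.k + 1) := by
  obtain ⟨hj1, hjN, hlo0, hL0, hk0⟩ := id H
  refine ⟨σ.j + 1, ⟨σ.k, H.k_nonneg, by ring, by omega, hm, ?_, ?_, Or.inl (by omega)⟩, ?_⟩
  · omega
  · omega
  · have := not_doneFace_current (C := C) σ
    rwa [show σ.j + 2 * σ.k + 1 - 1 = σ.j + 2 * σ.k by ring, show σ.j + 1 - 1 = σ.j by ring,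
      show σ.a - σ.k - 1 + 1 = σ.a - σ.k by ring]

/-- Before the step, the horizontal slot of the current face is alive. -/
theorem StepHyp.aliveH_cur : AliveH C σ (σ.a - σ.k) (σ.j + 2 * σ.k) := by
  obtain ⟨hj1, hjN, hlo0, hL0, hk0⟩ := id H
  rcases lt_or_eq_of_le H.k_nonneg with hk | hk
  · exact Or.inr ⟨by omega, rfl, rfl⟩
  · left
    refine ⟨by omega, ?_⟩
    rintro ⟨i, hi0, hir, -, -, -, -, hdone⟩
    rcases hdone with h | ⟨-, h | ⟨h, hik⟩⟩ <;> omega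

/-- Before the step, the target horizontal slot two levels up is empty. -/
theorem StepHyp.not_aliveH_target : ¬ AliveH C σ (σ.a - σ.k - 1) (σ.j + 2 * σ.k + 2) := by
  obtain ⟨hj1, hjN, hlo0, hL0, hk0⟩ := id H
  rintro (⟨hm, hnd⟩ | ⟨-, hb, -⟩)
  · apply hnd
    refine ⟨0, le_rfl, by ring, by omega, hm, ?_, ?_, Or.inl (by omega)⟩
    · omega
    · omega
  · omega

/-- The two horizontal slots at the apex level `j + 2k + 1` are empty, at the state `σ` … -/
theorem StepHyp.not_aliveH_apex_level {b : ℤ} (hb : σ.a - σ.k - 1 ≤ b) (hb' : b ≤ σ.a - σ.k) :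
    ¬ AliveH C σ b (σ.j + 2 * σ.k + 1) := by
  obtain ⟨hj1, hjN, hlo0, hL0, hk0⟩ := id H
  rintro (⟨hm, hnd⟩ | ⟨-, -, hm⟩)
  · apply hnd
    refine ⟨0, le_rfl, by ring, by omega, hm, ?_, ?_, Or.inl (by omega)⟩
    · omega
    · omega
  · omega

/-- … and at the next state. -/
theorem StepHyp.not_aliveH_apex_level_succ {b : ℤ} (hb : σ.a - σ.k - 1 ≤ b) (hb' : b ≤ σ.a - σ.k) :
    ¬ AliveH C σ.succ b (σ.j + 2 * σ.k + 1) := by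
  obtain ⟨hj1, hjN, hlo0, hL0, hk0⟩ := id H
  rintro (⟨hm, hnd⟩ | ⟨-, -, hm⟩)
  · apply hnd
    apply DoneFace.succ H.k_nonneg
    refine ⟨0, le_rfl, by ring, by omega, hm, ?_, ?_, Or.inl (by omega)⟩
    · omega
    · omega
  · simp only [St.succ] at hm; omega

/-- **After the step, the current face is done by the current row.** -/
theorem StepHyp.doneFace_cur_succ (hm : σ.j + 2 * σ.k ≤ C.N - 1) :
    DoneFace C σ.succ (σ.a - σ.k) (σ.j + 2 * σ.k) σ.j :=
  (doneFace_succ_iff σ H.k_nonneg _ _ _).2 (Or.inr ⟨rfl, rfl, rfl, H.j_pos, hm, H.lo_le, H.le_L⟩)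

/-- After the step, the flag of `v` at the current face is up. -/
theorem StepHyp.flagV_cur_succ (hm : σ.j + 2 * σ.k ≤ C.N - 1) :
    FlagV C σ.succ (σ.a - σ.k) (σ.j + 2 * σ.k) := by
  obtain ⟨hj1, hjN, hlo0, hL0, hk0⟩ := id H
  refine ⟨σ.j, H.doneFace_cur_succ hm, fun h => ?_⟩
  have := doneFace_row_lt h
  simp only [St.succ] at this; omega

/-- After the step, the flag of `d` at the current face is up. -/
theorem StepHyp.flagD_cur_succ (hm : σ.j + 2 * σ.k ≤ C.N - 1) :
    FlagD C σ.succ (σ.a - σ.k) (σ.j + 2 * σ.k) := by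
  obtain ⟨hj1, hjN, hlo0, hL0, hk0⟩ := id H
  refine ⟨σ.j, H.doneFace_cur_succ hm, fun h => ?_⟩
  have := doneFace_row_lt h
  simp only [St.succ] at this; omega

/-- After a double step, the flag of the upper `v`-edge of the apex is down. -/
theorem StepHyp.not_flagV_apex_succ (hm : σ.j + 2 * σ.k + 1 ≤ C.N - 1) :
    ¬ FlagV C σ.succ (σ.a - σ.k) (σ.j + 2 * σ.k + 1) := by
  obtain ⟨hj1, hjN, hlo0, hL0, hk0⟩ := id H
  rintro ⟨r, hd, hnd⟩
  apply hnd
  rw [doneFace_succ_iff σ H.k_nonneg] at hd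
  rcases hd with ⟨i, hi0, hir, hr1, hmN, hlo, hL, hdone⟩ | ⟨-, -, h, -⟩
  · -- an old step at the face `(a-k, m+1)`: row `r = j + 1 + 2s`, `i = k - s`
    have hrj : σ.j < r := by
      rcases hdone with h | ⟨rfl, h | ⟨h, hik⟩⟩
      · exact h
      · omega
      · omega
    rw [show σ.j + 2 * σ.k + 1 - 1 = σ.j + 2 * σ.k by ring]
    rcases lt_or_eq_of_le (show σ.j + 1 ≤ r by omega) with hr | hr
    · -- `s ≥ 1`: the face `(a-k, m)` was stepped by the row `r - 1 = j + 2s`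
      apply DoneFace.succ H.k_nonneg
      have h2 : ∃ s, r = σ.j + 1 + 2 * s := ⟨σ.k - i, by omega⟩
      obtain ⟨s, hs⟩ := h2
      rw [hs, show σ.j + 1 + 2 * s - 1 = σ.j + 2 * s by ring]
      exact H.doneFace_above (by omega) (by omega) (by omega)
    · -- `s = 0`: the new face
      rw [← hr, show σ.j + 1 - 1 = σ.j by ring]
      exact H.doneFace_cur_succ (by omega)
  · omega

/-- After a double step, the flag of the upper `d`-edge of the apex is down. -/
theorem StepHyp.not_flagD_apex_succ (hm : σ.j + 2 * σ.k + 1 ≤ C.N - 1) :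
    ¬ FlagD C σ.succ (σ.a - σ.k - 1) (σ.j + 2 * σ.k + 1) := by
  obtain ⟨hj1, hjN, hlo0, hL0, hk0⟩ := id H
  rintro ⟨r, hd, hnd⟩
  apply hnd
  rw [doneFace_succ_iff σ H.k_nonneg] at hd
  rcases hd with ⟨i, hi0, hir, hr1, hmN, hlo, hL, hdone⟩ | ⟨-, h, -⟩
  · have hrj : σ.j < r := by
      rcases hdone with h | ⟨rfl, h | ⟨h, hik⟩⟩
      · exact h
      · omega
      · omega
    rw [show σ.j + 2 * σ.k + 1 - 1 = σ.j + 2 * σ.k by ring, show σ.a - σ.k - 1 + 1 = σ.a - σ.k by ring]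
    rcases lt_or_eq_of_le (show σ.j + 1 ≤ r by omega) with hr | hr
    · apply DoneFace.succ H.k_nonneg
      have h2 : ∃ s, r = σ.j + 1 + 2 * s := ⟨σ.k - i, by omega⟩
      obtain ⟨s, hs⟩ := h2
      rw [hs, show σ.j + 1 + 2 * s - 1 = σ.j + 2 * s by ring]
      exact H.doneFace_above (by omega) (by omega) (by omega)
    · rw [← hr, show σ.j + 1 - 1 = σ.j by ring]
      exact H.doneFace_cur_succ (by omega)
  · omega

/-- After the step, the horizontal slot of the current face is empty. -/
theorem StepHyp.not_aliveH_cur_succ (hm : σ.j + 2 * σ.k ≤ C.N - 1) :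
    ¬ AliveH C σ.succ (σ.a - σ.k) (σ.j + 2 * σ.k) := by
  obtain ⟨hj1, hjN, hlo0, hL0, hk0⟩ := id H
  rintro (⟨-, hnd⟩ | ⟨-, hb, -⟩)
  · apply hnd
    rcases lt_or_eq_of_le H.k_nonneg with hk | hk
    · apply DoneFace.succ H.k_nonneg
      have := H.doneFace_above (s := σ.k) (by omega) le_rfl hm
      rwa [show σ.j + 2 * σ.k = σ.j + 2 * σ.k from rfl] at this
    · have := H.doneFace_cur_succ hm
      rw [← hk, mul_zero, add_zero, sub_zero] at this ⊢
      exact this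
  · simp only [St.succ] at hb; omega

/-- After a double step, the travelling edge sits two levels up. -/
theorem StepHyp.aliveH_target_succ : AliveH C σ.succ (σ.a - σ.k - 1) (σ.j + 2 * σ.k + 2) :=
  Or.inr ⟨by simp only [St.succ]; linarith [H.k_nonneg], by simp only [St.succ]; ring,
    by simp only [St.succ]; ring⟩

/-! #### Slots that a step does not touch -/

/-- A step changes `FlagV` only at the current face and at the apex. -/
theorem StepHyp.flagV_succ_iff {b m : ℤ}
    (h1 : ¬ (b = σ.a - σ.k ∧ m = σ.j + 2 * σ.k)) (h2 : ¬ (b = σ.a - σ.k ∧ m = σ.j + 2 * σ.k + 1)) :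
    FlagV C σ.succ b m ↔ FlagV C σ b m := by
  simp only [FlagV, doneFace_succ_iff σ H.k_nonneg]
  refine exists_congr fun r => ?_
  constructor
  · rintro ⟨hd | ⟨-, hb, hm, -⟩, hnd⟩
    · exact ⟨hd, fun h => hnd (Or.inl h)⟩
    · exact absurd ⟨hb, hm⟩ h1
  · rintro ⟨hd, hnd⟩
    refine ⟨Or.inl hd, ?_⟩
    rintro (h | ⟨-, hb, hm, -⟩)
    · exact hnd h
    · exact h2 ⟨hb, by omega⟩

/-- A step changes `FlagD` only at the current face and at the left neighbour of the apex. -/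
theorem StepHyp.flagD_succ_iff {b m : ℤ}
    (h1 : ¬ (b = σ.a - σ.k ∧ m = σ.j + 2 * σ.k)) (h2 : ¬ (b = σ.a - σ.k - 1 ∧ m = σ.j + 2 * σ.k + 1)) :
    FlagD C σ.succ b m ↔ FlagD C σ b m := by
  simp only [FlagD, doneFace_succ_iff σ H.k_nonneg]
  refine exists_congr fun r => ?_
  constructor
  · rintro ⟨hd | ⟨-, hb, hm, -⟩, hnd⟩
    · exact ⟨hd, fun h => hnd (Or.inl h)⟩
    · exact absurd ⟨hb, hm⟩ h1
  · rintro ⟨hd, hnd⟩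
    refine ⟨Or.inl hd, ?_⟩
    rintro (h | ⟨-, hb, hm, -⟩)
    · exact hnd h
    · exact h2 ⟨by omega, by omega⟩

/-- A step changes `AliveH` only at the current face and at the target slot. -/
theorem StepHyp.aliveH_succ_iff {b m : ℤ}
    (h1 : ¬ (b = σ.a - σ.k ∧ m = σ.j + 2 * σ.k)) (h2 : ¬ (b = σ.a - σ.k - 1 ∧ m = σ.j + 2 * σ.k + 2)) :
    AliveH C σ.succ b m ↔ AliveH C σ b m := by
  have hk := H.k_nonneg
  unfold AliveH
  rw [doneFace_succ_iff σ hk]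
  simp only [Transient, St.succ]
  constructor
  · rintro (⟨hm, hnd⟩ | ⟨-, hb, hm⟩)
    · exact Or.inl ⟨hm, fun h => hnd (Or.inl h)⟩
    · exact absurd ⟨by omega, by omega⟩ h2
  · rintro (⟨hm, hnd⟩ | ⟨-, hb, hm⟩)
    · refine Or.inl ⟨hm, ?_⟩
      rintro (h | ⟨-, hb, hm', -⟩)
      · exact hnd h
      · exact h1 ⟨hb, hm'⟩
    · exact absurd ⟨hb, hm⟩ h1

end StepFacts

end Summit.CriticalPhenomena.CardyFormulaZ2.Theorems.TriSweep

end
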